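import Summits.AtomisticToContinuum.BoseEinsteinCondensation.Theorems.HardCoreExtension.Negative.ForceStructureDensityWave

/-!
# Negative lemmas for crux `HardCoreExtension` (stmt-AtomisticToContinuum-11786) — line
# `third-law-current-floor`, stub S2 `stub_forceStructureBound` (CFB), II: MINIMALITY IS
# LOAD-BEARING, at energy resolution `O(ρ)` uniformly in `N`

Supports (does not close) stmt-AtomisticToContinuum-11786 (route `BECConjugateDomination`); drefute
seat on the picked line `Cruxes/HardCoreExtension/Lines/third-law-current-floor.lean`.

The line's load-bearing stub S2 asserts, for every bounded admissible `v` of range `≤ R` and every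
positive real EXACT minimiser `Ψ` of the periodic `(n+1)`-body energy on the torus of side
`L = ((n+1)/ρ)^{1/3}`, the force-structure bound
`D_k := ∫_{cell^N} |∑ⱼ e_m(xⱼ) (k·∇ⱼ)Ψ|² ≤ C ρ |k|² (n+1)` (`k = 2πm/L`, `m ≠ 0`), `C = C(R)`,
`ρ < ρ₀(R)`, eventually in `n`.  Here we show what a proof of S2 must use:

* `ForceStructureBoundSlack s` — S2 with exact minimality `E(Ψ) = E₀` weakened to the FIXED slack
  `E(Ψ) ≤ E₀ + s` (`s > 0` independent of `N`: an intensive `O(1)` amount of energy) — is FALSE for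
  every `s > 0` (`not_forceStructureBoundSlack`); a fortiori S2 with minimality deleted is false
  (`not_forceStructureBoundWithoutMinimality`).  Both refuted statements imply the stub as typed
  (`ForceStructureBoundExact`, `forceStructureBoundExact_of_slack`), which is NOT refuted here.
* Witness: the free gas `v ≡ 0` (bounded, admissible, every range) and the density wave of file I
  with `ε² = s/(4NK)`, `K = (2π/L)²`, `NK = 4π²ρL`: energy `≤ 16π²ε²N/L² = s = E₀ + s`, while
  `D_{e₀} ≥ N²K²ε²/(1+2ε²)² ≥ (16/81)·NKs` (`forceStructure_waveState_ge`, `ε² ≤ 1/16` once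
  `L ≥ s/(π²ρ)`), against `D ≤ CρKN ≤ NKs/6` for `ρ ≤ s/(6C)` — and `ρ < ρ₀` is free.  So ANY proof
  of S2 must use minimality at energy resolution `o(ρ)` uniformly in `N` (finer than every energy
  asymptotics in print, all of which have errors `≫ ρ`); against this family a slack `δ` chosen
  AFTER `n` (`δ ≤ 2Cρ`) is harmless.  (Compare `InfraredMinimumUncertainty.Negative.MinimalityLoadBearing`:
  IMU dies already at slack `~ 1/L² → 0`; CFB is quadratic in `ε` like the energy, hence more local —
  but still not an energy statement.)
-/

noncomputable section

open MeasureTheory Filter Set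
open scoped ENNReal NNReal Topology ComplexConjugate BigOperators

namespace Summit.AtomisticToContinuum.BoseEinsteinCondensation.Theorems.HardCoreExtension.Negative

open Literature.MathematicalPhysics.QuantumManyBody.BoseGas
open Summit.AtomisticToContinuum.BoseEinsteinCondensation.Theorems.InfraredMinimumUncertainty.Negative
  (waveFun waveState waveState_ψ waveFun_eq_norm waveFun_ne_zero periodicEnergy_waveState_le
    periodicGroundStateEnergy_free)
open Summit.AtomisticToContinuum.BoseEinsteinCondensation.Theorems.StaticResponseBound.Negative
  (isRepulsiveFiniteRange_zero)
open Summit.AtomisticToContinuum.BoseEinsteinCondensation.Theorems.CorrectorClosure.Negative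
  (e0 e0_ne_zero sideLength_succ_pos)

/-! ## The statements: S2 as typed, S2 with a fixed slack, S2 without minimality -/

/-- Stub S2 `stub_forceStructureBound` of `Cruxes/HardCoreExtension/Lines/third-law-current-floor.lean`,
VERBATIM (positive real EXACT minimisers of bounded admissible potentials of range `≤ R`).  Recorded
only to certify that the two refuted statements below are strengthenings of it
(`forceStructureBoundExact_of_slack`); it is NOT refuted here. -/
def ForceStructureBoundExact : Prop :=
  ∀ R : ℝ, 0 < R → ∃ C : ℝ, 0 < C ∧ ∃ ρ₀ : ℝ, 0 < ρ₀ ∧ ∀ ρ : ℝ, 0 < ρ → ρ < ρ₀ →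
    ∀ᶠ n : ℕ in atTop, ∀ v : ℝ → ℝ≥0∞, IsRepulsiveFiniteRange v →
      (∃ M : ℝ≥0∞, M ≠ ⊤ ∧ ∀ r, v r ≤ M) → (∀ r, R < r → v r = 0) →
      ∀ Ψ : PeriodicTrialState (n + 1) (sideLength ρ (n + 1)),
        periodicEnergy v Ψ = periodicGroundStateEnergy v (n + 1) (sideLength ρ (n + 1)) →
        periodicEnergy v Ψ ≠ ⊤ → (∀ X, Ψ.ψ X = (‖Ψ.ψ X‖ : ℂ)) → (∀ X, Ψ.ψ X ≠ 0) →
        ∀ m : Fin 3 → ℤ, m ≠ 0 →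
          (∫ X in cellN (n + 1) (sideLength ρ (n + 1)),
              ‖∑ j : Fin (n + 1), cellWave (sideLength ρ (n + 1)) m (X j) *
                  fderiv ℝ Ψ.ψ X
                    (Pi.single j ((2 * Real.pi / sideLength ρ (n + 1)) • latticeVec 1 m))‖ ^ 2) ≤
            C * ρ * ‖(2 * Real.pi / sideLength ρ (n + 1)) • latticeVec 1 m‖ ^ 2 * ((n : ℝ) + 1)

/-- S2 with exact minimality `E(Ψ) = E₀` weakened to a FIXED slack `E(Ψ) ≤ E₀ + s` (`s` independent
of `n`, chosen before everything).  FALSE for every `s > 0` (`not_forceStructureBoundSlack`). -/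
def ForceStructureBoundSlack (s : ℝ) : Prop :=
  ∀ R : ℝ, 0 < R → ∃ C : ℝ, 0 < C ∧ ∃ ρ₀ : ℝ, 0 < ρ₀ ∧ ∀ ρ : ℝ, 0 < ρ → ρ < ρ₀ →
    ∀ᶠ n : ℕ in atTop, ∀ v : ℝ → ℝ≥0∞, IsRepulsiveFiniteRange v →
      (∃ M : ℝ≥0∞, M ≠ ⊤ ∧ ∀ r, v r ≤ M) → (∀ r, R < r → v r = 0) →
      ∀ Ψ : PeriodicTrialState (n + 1) (sideLength ρ (n + 1)),
        periodicEnergy v Ψ ≤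
            periodicGroundStateEnergy v (n + 1) (sideLength ρ (n + 1)) + ENNReal.ofReal s →
        periodicEnergy v Ψ ≠ ⊤ → (∀ X, Ψ.ψ X = (‖Ψ.ψ X‖ : ℂ)) → (∀ X, Ψ.ψ X ≠ 0) →
        ∀ m : Fin 3 → ℤ, m ≠ 0 →
          (∫ X in cellN (n + 1) (sideLength ρ (n + 1)),
              ‖∑ j : Fin (n + 1), cellWave (sideLength ρ (n + 1)) m (X j) *
                  fderiv ℝ Ψ.ψ X
                    (Pi.single j ((2 * Real.pi / sideLength ρ (n + 1)) • latticeVec 1 m))‖ ^ 2) ≤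
            C * ρ * ‖(2 * Real.pi / sideLength ρ (n + 1)) • latticeVec 1 m‖ ^ 2 * ((n : ℝ) + 1)

/-- S2 with the minimality hypothesis DELETED (every positive real finite-energy state).  FALSE
(`not_forceStructureBoundWithoutMinimality`). -/
def ForceStructureBoundWithoutMinimality : Prop :=
  ∀ R : ℝ, 0 < R → ∃ C : ℝ, 0 < C ∧ ∃ ρ₀ : ℝ, 0 < ρ₀ ∧ ∀ ρ : ℝ, 0 < ρ → ρ < ρ₀ →
    ∀ᶠ n : ℕ in atTop, ∀ v : ℝ → ℝ≥0∞, IsRepulsiveFiniteRange v →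
      (∃ M : ℝ≥0∞, M ≠ ⊤ ∧ ∀ r, v r ≤ M) → (∀ r, R < r → v r = 0) →
      ∀ Ψ : PeriodicTrialState (n + 1) (sideLength ρ (n + 1)),
        periodicEnergy v Ψ ≠ ⊤ → (∀ X, Ψ.ψ X = (‖Ψ.ψ X‖ : ℂ)) → (∀ X, Ψ.ψ X ≠ 0) →
        ∀ m : Fin 3 → ℤ, m ≠ 0 →
          (∫ X in cellN (n + 1) (sideLength ρ (n + 1)),
              ‖∑ j : Fin (n + 1), cellWave (sideLength ρ (n + 1)) m (X j) *
                  fderiv ℝ Ψ.ψ X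
                    (Pi.single j ((2 * Real.pi / sideLength ρ (n + 1)) • latticeVec 1 m))‖ ^ 2) ≤
            C * ρ * ‖(2 * Real.pi / sideLength ρ (n + 1)) • latticeVec 1 m‖ ^ 2 * ((n : ℝ) + 1)

/-- The fixed-slack form implies the stub as typed (an exact minimiser has every slack `s ≥ 0`).
[folklore] -/
theorem forceStructureBoundExact_of_slack {s : ℝ} (h : ForceStructureBoundSlack s) :
    ForceStructureBoundExact := by
  intro R hR
  obtain ⟨C, hC, ρ₀, hρ₀, h⟩ := h R hR
  refine ⟨C, hC, ρ₀, hρ₀, fun ρ hρ hρ₀' => ?_⟩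
  filter_upwards [h ρ hρ hρ₀'] with n hn
  intro v hv hbdd hvR Ψ hmin
  exact hn v hv hbdd hvR Ψ (hmin ▸ le_self_add)

/-- Deleting minimality is stronger than any fixed slack. [folklore] -/
theorem forceStructureBoundSlack_of_withoutMinimality (s : ℝ)
    (h : ForceStructureBoundWithoutMinimality) : ForceStructureBoundSlack s := by
  intro R hR
  obtain ⟨C, hC, ρ₀, hρ₀, h⟩ := h R hR
  refine ⟨C, hC, ρ₀, hρ₀, fun ρ hρ hρ₀' => ?_⟩
  filter_upwards [h ρ hρ hρ₀'] with n hn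
  intro v hv hbdd hvR Ψ _hslack
  exact hn v hv hbdd hvR Ψ

/-! ## Real-power bookkeeping for `L = ((n+1)/ρ)^{1/3}` -/

/-- `(x^{1/3})³ = x` for `x ≥ 0`. [folklore] -/
theorem rpow_third_pow_three {x : ℝ} (hx : 0 ≤ x) : (x ^ (1 / 3 : ℝ)) ^ 3 = x := by
  have h := Real.rpow_inv_natCast_pow hx (n := 3) (by norm_num)
  norm_num at h
  exact h

/-- `(x³)^{1/3} = x` for `x ≥ 0`. [folklore] -/
theorem pow_three_rpow_third {x : ℝ} (hx : 0 ≤ x) : (x ^ 3) ^ (1 / 3 : ℝ) = x := by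
  have h := Real.pow_rpow_inv_natCast hx (n := 3) (by norm_num)
  norm_num at h
  exact h

/-- The torus grows: eventually `L₀ ≤ sideLength ρ (n+1)`. [folklore] -/
theorem eventually_le_sideLength {ρ : ℝ} (hρ : 0 < ρ) {L₀ : ℝ} (hL₀ : 0 ≤ L₀) :
    ∀ᶠ n : ℕ in atTop, L₀ ≤ sideLength ρ (n + 1) := by
  refine (eventually_ge_atTop ⌈ρ * L₀ ^ 3⌉₊).mono fun n hn => ?_
  have hn' : ρ * L₀ ^ 3 ≤ (n : ℝ) + 1 := by
    have h1 : ρ * L₀ ^ 3 ≤ (⌈ρ * L₀ ^ 3⌉₊ : ℝ) := Nat.le_ceil _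
    have h2 : (⌈ρ * L₀ ^ 3⌉₊ : ℝ) ≤ n := by exact_mod_cast hn
    linarith
  have hx : L₀ ^ 3 ≤ (((n + 1 : ℕ) : ℝ)) / ρ := by
    rw [le_div_iff₀ hρ]
    push_cast
    linarith
  unfold sideLength
  calc L₀ = (L₀ ^ 3) ^ (1 / 3 : ℝ) := (pow_three_rpow_third hL₀).symm
    _ ≤ (((n + 1 : ℕ) : ℝ) / ρ) ^ (1 / 3 : ℝ) := Real.rpow_le_rpow (by positivity) hx (by norm_num)

/-! ## Minimality is load-bearing: the refutations -/

/-- **S2 with any FIXED slack is false.**  For every `s > 0`, `ForceStructureBoundSlack s` fails: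
take `R = 1`, the asserted `C, ρ₀`, then `ρ = min(ρ₀/2, s/(6C))`, `n` large with `L ≥ s/(π²ρ)`,
`v ≡ 0` and the density wave with `ε² = s/(4NK)` (`K = (2π/L)²`, `NK = 4π²ρL`): energy `≤ s = E₀ + s`
and `D ≥ N²K²ε²/(1+2ε²)² ≥ (16/81)NKs`, against `D ≤ CρKN ≤ NKs/6`. [folklore] -/
theorem not_forceStructureBoundSlack {s : ℝ} (hs : 0 < s) : ¬ ForceStructureBoundSlack s := by
  intro h
  obtain ⟨C, hC, ρ₀, hρ₀, h⟩ := h 1 one_pos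
  -- the density: `ρ < ρ₀` and `6 C ρ ≤ s`
  obtain ⟨ρ, hρ, hρρ₀, hρs⟩ : ∃ ρ : ℝ, 0 < ρ ∧ ρ < ρ₀ ∧ 6 * C * ρ ≤ s := by
    refine ⟨min (ρ₀ / 2) (s / (6 * C)), lt_min (by positivity) (by positivity),
      (min_le_left _ _).trans_lt (by linarith), ?_⟩
    have : min (ρ₀ / 2) (s / (6 * C)) ≤ s / (6 * C) := min_le_right _ _
    rw [le_div_iff₀ (by positivity)] at this
    linarith
  -- a large torus: `s/(π²ρ) ≤ L`
  have hπ : 0 < Real.pi := Real.pi_pos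
  obtain ⟨n, hn, hnL⟩ :=
    ((h ρ hρ hρρ₀).and (eventually_le_sideLength hρ (L₀ := s / (Real.pi ^ 2 * ρ))
      (by positivity))).exists
  set L : ℝ := sideLength ρ (n + 1) with hLdef
  have hL : 0 < L := sideLength_succ_pos hρ n
  have hL3 : L ^ 3 = ((n : ℝ) + 1) / ρ := by
    rw [hLdef]
    unfold sideLength
    rw [rpow_third_pow_three (by positivity)]
    push_cast
    ring
  have hNr : (0 : ℝ) < (n : ℝ) + 1 := by positivity
  have hN : ((n : ℝ) + 1) = ρ * L ^ 3 := by rw [hL3]; field_simp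
  have hNK : ((n : ℝ) + 1) * (2 * Real.pi / L) ^ 2 = 4 * Real.pi ^ 2 * ρ * L := by
    rw [hN]; field_simp; ring
  have hNK0 : 0 < ((n : ℝ) + 1) * (2 * Real.pi / L) ^ 2 := by positivity
  have hsL : s ≤ Real.pi ^ 2 * ρ * L := by
    have := hnL
    rw [div_le_iff₀ (by positivity)] at this
    linarith
  -- the amplitude `ε² = s / (4 N K) ≤ 1/16`
  set ε : ℝ := Real.sqrt (s / (4 * (((n : ℝ) + 1) * (2 * Real.pi / L) ^ 2))) with hεdef
  have hε0 : 0 ≤ ε := Real.sqrt_nonneg _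
  have hε2 : ε ^ 2 = s / (4 * (((n : ℝ) + 1) * (2 * Real.pi / L) ^ 2)) :=
    Real.sq_sqrt (by positivity)
  have hε16 : ε ^ 2 ≤ 1 / 16 := by
    rw [hε2, hNK, div_le_iff₀ (by positivity)]
    linarith
  have hε : |ε| < 1 / 2 := by
    refine abs_lt_of_sq_lt_sq ?_ (by norm_num)
    have : (1 / 2 : ℝ) ^ 2 = 1 / 4 := by norm_num
    rw [this]
    linarith
  -- the witness: free gas, density wave
  have hE0 : periodicGroundStateEnergy (0 : ℝ → ℝ≥0∞) (n + 1) L = 0 :=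
    periodicGroundStateEnergy_free hL n
  have hEreal : 16 * Real.pi ^ 2 * ε ^ 2 * ((n : ℝ) + 1) / L ^ 2 = s := by
    have e1 : 16 * Real.pi ^ 2 * ε ^ 2 * ((n : ℝ) + 1) / L ^ 2 =
        4 * (((n : ℝ) + 1) * (2 * Real.pi / L) ^ 2) * ε ^ 2 := by
      field_simp
      ring
    rw [e1, hε2]
    field_simp
  have hEle := periodicEnergy_waveState_le (n := n) (ε := ε) hL
  rw [hEreal] at hEle
  have hE : periodicEnergy (0 : ℝ → ℝ≥0∞) (waveState n hL ε) ≤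
      periodicGroundStateEnergy 0 (n + 1) L + ENNReal.ofReal s := by
    rw [hE0, zero_add]
    exact hEle
  have hfin : periodicEnergy (0 : ℝ → ℝ≥0∞) (waveState n hL ε) ≠ ⊤ :=
    ne_top_of_le_ne_top ENNReal.ofReal_ne_top hEle
  have key := hn 0 isRepulsiveFiniteRange_zero ⟨0, ENNReal.zero_ne_top, fun _ => le_rfl⟩
    (fun _ _ => rfl) (waveState n hL ε) hE hfin (waveFun_eq_norm hL hε) (waveFun_ne_zero hL hε)
    e0 e0_ne_zero
  simp only [waveState_ψ] at key
  have hnorm : ‖(2 * Real.pi / L) • latticeVec 1 e0‖ = 2 * Real.pi / L := norm_waveVec hL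
  rw [hnorm] at key
  -- the lower bound
  have hlow := forceStructure_waveState_ge (n := n) hL hε
  simp only [waveVec] at hlow
  have hchain := hlow.trans key
  -- arithmetic: `N²K²ε²/(1+2ε²)² ≤ CρKN`, `(1+2ε²)² ≤ 81/64`, `Nε²K = s/4`, `6Cρ ≤ s`
  have h12 : (0 : ℝ) < 1 + 2 * ε ^ 2 := by positivity
  have hlhs : (((n : ℝ) + 1) * (ε * (2 * Real.pi / L) ^ 2 / (1 + 2 * ε ^ 2))) ^ 2 =
      ((n : ℝ) + 1) ^ 2 * ε ^ 2 * ((2 * Real.pi / L) ^ 2) ^ 2 / (1 + 2 * ε ^ 2) ^ 2 := by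
    field_simp
  rw [hlhs, div_le_iff₀ (by positivity)] at hchain
  have hb : (1 + 2 * ε ^ 2) ^ 2 ≤ 81 / 64 := by nlinarith [hε16, sq_nonneg ε]
  have h1 : ((n : ℝ) + 1) ^ 2 * ε ^ 2 * ((2 * Real.pi / L) ^ 2) ^ 2 ≤
      C * ρ * (2 * Real.pi / L) ^ 2 * ((n : ℝ) + 1) * (81 / 64) :=
    hchain.trans (mul_le_mul_of_nonneg_left hb (by positivity))
  have hs4 : ((n : ℝ) + 1) * ε ^ 2 * (2 * Real.pi / L) ^ 2 = s / 4 := by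
    rw [hε2]
    field_simp
  have h2 : ((n : ℝ) + 1) ^ 2 * ε ^ 2 * ((2 * Real.pi / L) ^ 2) ^ 2 =
      (((n : ℝ) + 1) * (2 * Real.pi / L) ^ 2) * (s / 4) := by
    rw [← hs4]; ring
  rw [h2, show C * ρ * (2 * Real.pi / L) ^ 2 * ((n : ℝ) + 1) * (81 / 64) =
      (((n : ℝ) + 1) * (2 * Real.pi / L) ^ 2) * (C * ρ * (81 / 64)) by ring] at h1
  have h3 : s / 4 ≤ C * ρ * (81 / 64) := le_of_mul_le_mul_left h1 hNK0
  have hCρ : 0 < C * ρ := by positivity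
  nlinarith [h3, hρs, hCρ]

/-- **S2 without minimality is false** (corollary: slack `s = 1`). [folklore] -/
theorem not_forceStructureBoundWithoutMinimality : ¬ ForceStructureBoundWithoutMinimality :=
  fun h => not_forceStructureBoundSlack one_pos (forceStructureBoundSlack_of_withoutMinimality 1 h)

end Summit.AtomisticToContinuum.BoseEinsteinCondensation.Theorems.HardCoreExtension.Negative
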